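/-
Copyright (c) 2026 the pub-hodgecm-mathlib formalisation cell (harness21).  Prover seat hodgecm-mathlib-K2E4-p03 (g2), Track B «K2-LIT» ∕ h413
(`stmt-HodgeConjecture-24833`), line `K2_E3_EllipticInputs`, unit U3, line U3-d (lead K2E3-p03): FILE C rung C1 — the TRANSVECTION class, part (ii-a₁) THE LEVEL IN COORDINATES.  2026-09-03.
-/
import Literature.NumberTheory.Automorphic.UnitaryThreeTransvectionShells     -- ★ `lower_eq_zero_of_commute_cornerUnipotent`, `commute_cornerUnipotent_of_commute`; brings ★ REG-FRAME (`coe_upperTriangularUnipotent_{mul,inv}`, `isIntMatrix_upperTriangularUnipotent_iff`), ★ `UnitaryThreeUnipotentCentralizers` (`Z(n(t)) = S·N`), ★ `UnitaryThreeSingularUnipotentClasses` (`d(z)`)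
import Literature.NumberTheory.Automorphic.SubgroupIndexDevissage            -- ★ `relIndex_eq_relIndex_of_coe_subset_mul` (torus removal)
import Literature.NumberTheory.Automorphic.UnitaryThreeLevelTwoCongruence       -- ★ `isIntMatrix_diagonal_three`
import HarnessLib

/-!
# K2_E3 road (h413), U3-d FILE C, rung C1 «TRANSVECTION CLASS» — part (ii-a₁): the level `Z(n(τ)) ∩ GL₃(𝒪)` IN COORDINATES and the Heisenberg ball subgroups
# `B(r₁, r₂)` over a `ℤᵐ⁰`-valued field with an isometric involution (Rogawski 1990 §3.9; the coordinates of the count `[C : d(t)Cd(t)⁻¹] = [𝒪 : t𝒪]·[𝒪⁻ : t²𝒪⁻]` of the sequel)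

Cell `pub/hodgecm-mathlib` (D-0151), Track B; U3-d line lead K2E3-p03 (g0) (FILE C SPEC 2026-09-03T22:56Z, RULINGS 23:04:51Z ⚑1∕⚑2, FINAL TARGET 23:06:30Z), dealer
K2E3-plan (g1).  The hypothesis (ii) of ★ p855453 §1 for the transvection class is ONE INDEX (the shared frame ★ p855528 `K2E3UnipotentAdaptedFrame` §4 turns it into the
Haar identity `hr` and transports it along the adapted unitary): for the corner transvection `u = n(τ)` of `U = U(σ, J₀)(K)`, the level `C := Z_U(n(τ)) ∩ GL₃(𝒪_K)` (the
`S_0` letter of ★ `UnitaryThreeTransvectionShells`) and the σ-fixed torus element `d(t) = diag(t, 1, t⁻¹)` (`σ t = t`, `0 < v t ≤ 1`):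
  **`[C : d(t) C d(t)⁻¹] = [𝒪_K : t𝒪_K] · [𝒪⁻ : t²𝒪⁻]`**, `𝒪⁻ = {σ y = −y} ∩ 𝒪_K` — stated with the two indices as the HYPOTHESIS LETTERS `hF1`, `hF⁻` of the
INDEX BRIDGES (K2E3-p21 (g2), `K2E3LocalLatticeScalingIndex`: both `= Q := (Nat.card 𝓀[K])^k` at a non-split place, `v t = exp(−k)`), so that the conclusion reads `= Q²`
(`a(transvection) = 2` in the line lead's exponent convention; print: `q_v⁴ = q_v^{d(u)}`).

THE MATHEMATICS (the Heisenberg dévissage; `2 ∈ 𝒪_K^×`).  `Z_U(n(τ)) = S·N` with `S = {diag(α, β, α) : ασα = βσβ = 1}`, `N = {u(x, z) = !![1,x,z;0,1,−σx;0,0,1] : z + σz + xσx = 0}`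
([Rogawski1990] §3.9; ★ `exists_coe_eq_torus_mul_upperUnipotent_of_commute`), `Ad d(t) : (x, z) ↦ (tx, t²z)`.  (§1) For radii `r₁² ≤ r₂` the `u(x, z)` with `v x ≤ r₁`,
`v z ≤ r₂` form a SUBGROUP `B(r₁, r₂)` (`u(x,z)u(x′,z′) = u(x+x′, z+z′−xσx′)`).  (§2) `g ∈ C ⟺ g = diag(α,β,α)·u(x,z)`, `α, β ∈` norm-one, `x, z ∈ 𝒪`; `B(1,1) = {g ∈ C : g₀₀ = g₁₁ = 1}`.
(§3) TORUS REMOVAL: `C ⊆ B(1,1)·dCd⁻¹` (the torus is `Ad d`-fixed), so `[C : dCd⁻¹] = [B(1,1) : dCd⁻¹ ∩ B(1,1)]` (★ `relIndex_eq_relIndex_of_coe_subset_mul`), and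
`dCd⁻¹ ∩ B(1,1) = B(v t, v t²)`.  (§4) x-STEP: `g ↦ g₀₁` is a homomorphism `B(1,1) → (K,+)` onto `𝒪` (`z := −xσx∕2`) with `B(vt, 1)` the preimage of `t𝒪`:
`[B(1,1) : B(vt,1)] = [𝒪 : t𝒪]`.  (§5) z-STEP: on `B(vt, 1)`, `g ↦ g₀₂ mod t²𝒪` is a homomorphism to `K ∕ t²𝒪` (the cross term `xσx′ ∈ t²𝒪`) with kernel `B(vt, vt²)` and image
`𝒪⁻ mod t²𝒪` (`z ≡ z + xσx∕2 ∈ 𝒪⁻`), so `[B(vt,1) : B(vt,vt²)] = [𝒪⁻ : 𝒪⁻ ∩ t²𝒪] = [𝒪⁻ : t²𝒪⁻]`.  (§6) Multiply.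

THEOREMS ONLY (no definition ∕ instance ∕ notation ∕ named fact ∕ `sorry`); imports ★ + HarnessLib; lane `--supports stmt-HodgeConjecture-24833 --as helper`.
HONEST LABEL: HC_CM is proved only modulo the 7 printed citations (2 remaining named inputs: hLiu418 = stmt-HodgeConjecture-24832, h413 =
stmt-HodgeConjecture-24833) until rung 0 closes; count-neutral helper of the U3-d line.  DYADIC SCOPE: `v 2 = 1` is assumed (tame and unramified odd places); the
dyadic-ramified residual (box `x ∈ 2𝒪`) is flagged to the line lead (RULING ⚑2).

## References
* [Rogawski1990] J. D. Rogawski, *Automorphic Representations of Unitary Groups in Three Variables*, Ann. of Math. Stud. 123 (1990), §3.9 p. 32 (`Z(n(t)) = S·N`); §8.1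
  Prop. 8.1.2 (b) p. 114 (`d(u) = dim G_γ∕G_{uγ}`).
* [HarishChandra1999AdmissibleDistributions] Harish-Chandra, *Admissible Invariant Distributions on Reductive p-adic Groups*, ULS 16 (1999), §3.1 Lemma 3.2.
* [Rao1972] R. Ranga Rao, *Orbital integrals in reductive groups*, Ann. of Math. (2) 96 (1972) 505–510 (the lattice count).
* [Serre1979] J.-P. Serre, *Local Fields*, GTM 67 (1979), Ch. II §3 (indices of valuation ideals).
-/

set_option autoImplicit false
-- the mandated namespace repeats the single-problem summit's segment (`HodgeConjecture.HodgeConjecture`), as in every `Theorems/*.lean` of this sub-problem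
set_option linter.dupNamespace false

noncomputable section

open Matrix
open scoped Matrix MatrixGroups Valued WithZero Pointwise
open Literature.NumberTheory.Automorphic Literature.NumberTheory.Automorphic.UnitaryGroup Literature.NumberTheory.Automorphic.HermitianLattice
open Literature.NumberTheory.Automorphic.UnitaryLatticeTree

namespace Summit.HodgeConjecture.HodgeConjecture.Cruxes.H413.K2E3TransvectionCentralizerLevel

variable {K : Type*} [Field K] (σ : K →+* K) [Valued K ℤᵐ⁰]

/-! ## §1 The Heisenberg ball subgroups `B(r₁, r₂)` -/

omit [Valued K ℤᵐ⁰] in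
/-- The additive law of the unipotent centraliser coordinates: `u(x,z)·u(x′,z′) = u(x + x′, z + z′ − x·σx′)`. [cite: Rogawski1990, §1.10 p. 9] -/
theorem coe_heis_mul {x z x' z' : K} {g g' : GL (Fin 3) K} (hg : (g : Matrix (Fin 3) (Fin 3) K) = !![1, x, z; 0, 1, -σ x; 0, 0, 1])
    (hg' : (g' : Matrix (Fin 3) (Fin 3) K) = !![1, x', z'; 0, 1, -σ x'; 0, 0, 1]) :
    ((g * g' : GL (Fin 3) K) : Matrix (Fin 3) (Fin 3) K) = !![1, x + x', z + z' - x * σ x'; 0, 1, -σ (x + x'); 0, 0, 1] := by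
  rw [coe_upperTriangularUnipotent_mul hg hg', map_add, neg_add, sub_eq_add_neg, ← mul_neg]

omit [Valued K ℤᵐ⁰] in
/-- The inverse in the unipotent centraliser coordinates: `u(x, z)⁻¹ = u(−x, −x·σx − z)`. [cite: Rogawski1990, §1.10 p. 9] -/
theorem coe_heis_inv {x z : K} {g : GL (Fin 3) K} (hg : (g : Matrix (Fin 3) (Fin 3) K) = !![1, x, z; 0, 1, -σ x; 0, 0, 1]) :
    ((g⁻¹ : GL (Fin 3) K) : Matrix (Fin 3) (Fin 3) K) = !![1, -x, -(x * σ x) - z; 0, 1, -σ (-x); 0, 0, 1] := by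
  rw [coe_upperTriangularUnipotent_inv hg, map_neg, neg_neg, mul_neg]

/-- **THE HEISENBERG BALL SUBGROUPS `B(r₁, r₂)`** (`σ` an isometric involution, radii with `r₁·r₁ ≤ r₂`): the `u(x, z) = !![1,x,z;0,1,−σx;0,0,1]` with `z + σz + xσx = 0`, `v x ≤ r₁`,
`v z ≤ r₂` form a subgroup of `GL₃(K)` (stated existentially; the cross term `xσx′` of the product has `v ≤ r₁² ≤ r₂`). [cite: Rogawski1990, §3.9 p. 32] [cite: Rao1972, Theorem] -/
theorem exists_subgroup_heisBall (hσ : ∀ a : K, σ (σ a) = a) (hσv : ∀ a : K, Valued.v (σ a) = Valued.v a) {r₁ r₂ : ℤᵐ⁰} (hr : r₁ * r₁ ≤ r₂) :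
    ∃ B : Subgroup (GL (Fin 3) K), ∀ g : GL (Fin 3) K, g ∈ B ↔
      ∃ x z : K, z + σ z + x * σ x = 0 ∧ Valued.v x ≤ r₁ ∧ Valued.v z ≤ r₂ ∧ (g : Matrix (Fin 3) (Fin 3) K) = !![1, x, z; 0, 1, -σ x; 0, 0, 1] := by
  let P : GL (Fin 3) K → Prop := fun g =>
    ∃ x z : K, z + σ z + x * σ x = 0 ∧ Valued.v x ≤ r₁ ∧ Valued.v z ≤ r₂ ∧ (g : Matrix (Fin 3) (Fin 3) K) = !![1, x, z; 0, 1, -σ x; 0, 0, 1]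
  refine ⟨{ carrier := setOf P, mul_mem' := ?_, one_mem' := ?_, inv_mem' := ?_ }, fun g => Iff.rfl⟩
  · rintro g g' ⟨x, z, hrel, hvx, hvz, hg⟩ ⟨x', z', hrel', hvx', hvz', hg'⟩
    refine ⟨x + x', z + z' - x * σ x', ?_, (Valuation.map_add _ _ _).trans (max_le hvx hvx'), ?_, coe_heis_mul σ hg hg'⟩
    · rw [map_sub, map_add, map_mul, hσ, map_add]
      linear_combination hrel + hrel'
    · refine (Valuation.map_sub _ _ _).trans (max_le ((Valuation.map_add _ _ _).trans (max_le hvz hvz')) ?_)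
      rw [Valuation.map_mul, hσv]
      exact (mul_le_mul' hvx hvx').trans hr
  · refine ⟨0, 0, by simp, by rw [map_zero]; exact zero_le, by rw [map_zero]; exact zero_le, ?_⟩
    rw [Units.val_one, map_zero, neg_zero]
    ext i j; fin_cases i <;> fin_cases j <;> simp
  · rintro g ⟨x, z, hrel, hvx, hvz, hg⟩
    refine ⟨-x, -(x * σ x) - z, ?_, by rwa [Valuation.map_neg], ?_, coe_heis_inv σ hg⟩
    · rw [map_sub, map_neg, map_mul, hσ, map_neg]
      linear_combination -hrel
    · refine (Valuation.map_sub _ _ _).trans (max_le ?_ hvz)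
      rw [Valuation.map_neg, Valuation.map_mul, hσv]
      exact (mul_le_mul' hvx hvx).trans hr

/-! ## §2 The level `C = Z_U(n(τ)) ∩ GL₃(𝒪)` in coordinates -/

/-- `σa·a = 1` forces `v a = 1` for an isometric `σ`. [cite: Serre1979, Ch. II §3] -/
theorem v_eq_one_of_norm_eq_one (hσv : ∀ a : K, Valued.v (σ a) = Valued.v a) {a : K} (h : σ a * a = 1) : Valued.v a = 1 := by
  have h2 : Valued.v a ^ 2 = 1 := by
    have h' := congrArg Valued.v h
    rwa [Valuation.map_mul, Valuation.map_one, hσv, ← pow_two] at h'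
  rcases pow_eq_one_iff.1 h2 with h1 | h0
  · exact h1
  · exact absurd h0 two_ne_zero

/-- **`C` IN COORDINATES** (`u = n(τ)`, `τ ≠ 0`, `σ` an isometric involution): `g ∈ U(σ, J₀)` commutes with `n(τ)` and is integral together with its inverse iff
`g = diag(α, β, α)·u(x, z)` with `σα·α = σβ·β = 1`, `z + σz + xσx = 0`, `x, z ∈ 𝒪` ([Rogawski1990] §3.9 «`G_u = S·N`», ★ `exists_coe_eq_torus_mul_upperUnipotent_of_commute`;
integrality of the factors from `v α = v β = 1`). [cite: Rogawski1990, §3.9 p. 32] [cite: Rao1972, Theorem] -/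
theorem mem_level_iff (hσ : ∀ a : K, σ (σ a) = a) (hσv : ∀ a : K, Valued.v (σ a) = Valued.v a) {τ : K} (hτ : τ ≠ 0) {u : GL (Fin 3) K}
    (hu : (u : Matrix (Fin 3) (Fin 3) K) = !![1, 0, τ; 0, 1, 0; 0, 0, 1]) (g : GL (Fin 3) K) :
    (g ∈ unitaryGroupOfForm σ ((StdForm.antidiagonal 3).over K) ∧ g * u = u * g ∧ IsIntMatrix (g : Matrix (Fin 3) (Fin 3) K) ∧
        IsIntMatrix ((g⁻¹ : GL (Fin 3) K) : Matrix (Fin 3) (Fin 3) K)) ↔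
      ∃ α β x z : K, σ α * α = 1 ∧ σ β * β = 1 ∧ z + σ z + x * σ x = 0 ∧ Valued.v x ≤ 1 ∧ Valued.v z ≤ 1 ∧
        (g : Matrix (Fin 3) (Fin 3) K) = Matrix.diagonal ![α, β, α] * !![1, x, z; 0, 1, -σ x; 0, 0, 1] := by
  constructor
  · rintro ⟨hgU, hcomm, hint, -⟩
    obtain ⟨α, β, x, z, hα, hβ, hrel, hg⟩ := exists_coe_eq_torus_mul_upperUnipotent_of_commute σ hσ hτ hu hgU hcomm
    have hvα : Valued.v α = 1 := v_eq_one_of_norm_eq_one σ hσv hα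
    have h01 : (g : Matrix (Fin 3) (Fin 3) K) 0 1 = α * x := by rw [hg]; simp [Matrix.mul_apply, Fin.sum_univ_three]
    have h02 : (g : Matrix (Fin 3) (Fin 3) K) 0 2 = α * z := by rw [hg]; simp [Matrix.mul_apply, Fin.sum_univ_three]
    refine ⟨α, β, x, z, hα, hβ, hrel, ?_, ?_, hg⟩
    · have h := hint 0 1
      rwa [h01, Valuation.map_mul, hvα, one_mul] at h
    · have h := hint 0 2
      rwa [h02, Valuation.map_mul, hvα, one_mul] at h
  · rintro ⟨α, β, x, z, hα, hβ, hrel, hvx, hvz, hg⟩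
    have hα0 : α ≠ 0 := right_ne_zero_of_mul_eq_one hα
    have hβ0 : β ≠ 0 := right_ne_zero_of_mul_eq_one hβ
    have hvα : Valued.v α = 1 := v_eq_one_of_norm_eq_one σ hσv hα
    have hvβ : Valued.v β = 1 := v_eq_one_of_norm_eq_one σ hσv hβ
    obtain ⟨m, hm, hm'⟩ := exists_units_coe_eq_torusS (K := K) hα0 hβ0
    obtain ⟨n, hn, hn'⟩ := exists_units_coe_eq_upperTriangularUnipotent x z (-σ x)
    have hgmn : g = m * n := Units.ext (by rw [Units.val_mul, hm, hn, hg])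
    have hmU : m ∈ unitaryGroupOfForm σ ((StdForm.antidiagonal 3).over K) :=
      (diagonal_mem_unitaryGroupOfForm_three_iff σ hm).2 ⟨hα, hβ, hα⟩
    have hnU : n ∈ unitaryGroupOfForm σ ((StdForm.antidiagonal 3).over K) :=
      (mem_unitaryGroupOfForm_iff_of_coe_eq_upperUnipotent σ hσ hn).2 ⟨rfl, hrel⟩
    have hvσx : Valued.v (-σ x) ≤ 1 := by rw [Valuation.map_neg, hσv]; exact hvx
    refine ⟨hgmn ▸ mul_mem hmU hnU, ?_, ?_, ?_⟩
    · refine Units.ext ?_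
      rw [Units.val_mul, Units.val_mul, hg, hu]
      exact torus_mul_upperUnipotent_commute_cornerUnipotent α β x z (-σ x) τ
    · rw [hgmn, Units.val_mul, hm]
      exact isIntMatrix_mul (isIntMatrix_diagonal_three hvα.le hvβ.le hvα.le) ((isIntMatrix_upperTriangularUnipotent_iff hn).2 ⟨hvx, hvz, hvσx⟩)
    · rw [hgmn, _root_.mul_inv_rev, Units.val_mul, hm']
      refine isIntMatrix_mul (isIntMatrix_inv_of_upperTriangularUnipotent hn hvx hvz hvσx) (isIntMatrix_diagonal_three ?_ ?_ ?_) <;>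
        simp [map_inv₀, hvα, hvβ]

omit [Valued K ℤᵐ⁰] in
/-- `diag(1, 1, 1) = 1`. [folklore] -/
theorem diagonal_one_one_one : (Matrix.diagonal ![(1 : K), 1, 1] : Matrix (Fin 3) (Fin 3) K) = 1 := by
  ext i j; fin_cases i <;> fin_cases j <;> simp

omit [Valued K ℤᵐ⁰] in
/-- Entries of `diag(α, β, α)·u(x, z)`: `(0,0) = α`, `(1,1) = β`, `(0,1) = αx`, `(0,2) = αz`. [cite: Rogawski1990, §1.10 p. 9] -/
theorem torus_mul_heis_apply (α β x z : K) :
    (Matrix.diagonal ![α, β, α] * !![1, x, z; 0, 1, -σ x; 0, 0, 1] : Matrix (Fin 3) (Fin 3) K) 0 0 = α ∧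
    (Matrix.diagonal ![α, β, α] * !![1, x, z; 0, 1, -σ x; 0, 0, 1] : Matrix (Fin 3) (Fin 3) K) 1 1 = β ∧
    (Matrix.diagonal ![α, β, α] * !![1, x, z; 0, 1, -σ x; 0, 0, 1] : Matrix (Fin 3) (Fin 3) K) 0 1 = α * x ∧
    (Matrix.diagonal ![α, β, α] * !![1, x, z; 0, 1, -σ x; 0, 0, 1] : Matrix (Fin 3) (Fin 3) K) 0 2 = α * z := by
  refine ⟨?_, ?_, ?_, ?_⟩ <;> simp [Matrix.mul_apply, Matrix.diagonal]

/-- **`B(1,1)` = THE UNIPOTENT ELEMENTS OF `C`**: `g ∈ C` with `g₀₀ = g₁₁ = 1` iff `g = u(x, z)` with `x, z ∈ 𝒪` (and the unitary relation). [cite: Rogawski1990, §3.9 p. 32] -/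
theorem mem_heisBall_one_iff (hσ : ∀ a : K, σ (σ a) = a) (hσv : ∀ a : K, Valued.v (σ a) = Valued.v a) {τ : K} (hτ : τ ≠ 0) {u : GL (Fin 3) K}
    (hu : (u : Matrix (Fin 3) (Fin 3) K) = !![1, 0, τ; 0, 1, 0; 0, 0, 1])
    {C : Subgroup (GL (Fin 3) K)} (hC : ∀ g : GL (Fin 3) K, g ∈ C ↔ g ∈ unitaryGroupOfForm σ ((StdForm.antidiagonal 3).over K) ∧ g * u = u * g ∧
      IsIntMatrix (g : Matrix (Fin 3) (Fin 3) K) ∧ IsIntMatrix ((g⁻¹ : GL (Fin 3) K) : Matrix (Fin 3) (Fin 3) K))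
    {B : Subgroup (GL (Fin 3) K)} (hB : ∀ g : GL (Fin 3) K, g ∈ B ↔
      ∃ x z : K, z + σ z + x * σ x = 0 ∧ Valued.v x ≤ 1 ∧ Valued.v z ≤ 1 ∧ (g : Matrix (Fin 3) (Fin 3) K) = !![1, x, z; 0, 1, -σ x; 0, 0, 1])
    (g : GL (Fin 3) K) :
    g ∈ B ↔ g ∈ C ∧ (g : Matrix (Fin 3) (Fin 3) K) 0 0 = 1 ∧ (g : Matrix (Fin 3) (Fin 3) K) 1 1 = 1 := by
  rw [hB, hC, mem_level_iff σ hσ hσv hτ hu]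
  constructor
  · rintro ⟨x, z, hrel, hvx, hvz, hg⟩
    refine ⟨⟨1, 1, x, z, by rw [map_one, one_mul], by rw [map_one, one_mul], hrel, hvx, hvz, by rw [diagonal_one_one_one, Matrix.one_mul, hg]⟩, ?_, ?_⟩ <;>
      simp [hg]
  · rintro ⟨⟨α, β, x, z, -, -, hrel, hvx, hvz, hg⟩, h00, h11⟩
    obtain ⟨e00, e11, -, -⟩ := torus_mul_heis_apply σ α β x z
    rw [hg, e00] at h00
    rw [hg, e11] at h11
    refine ⟨x, z, hrel, hvx, hvz, ?_⟩
    rw [hg, h00, h11, diagonal_one_one_one, Matrix.one_mul]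

/-! ## §3 Valuation balls as `AddSubgroup.map (mulLeft c)` -/

/-- `y ∈ c·O ⟺ v y ≤ v c` for the unit ball `O` and `c ≠ 0`. [cite: Serre1979, Ch. II §3] -/
theorem mem_map_mulLeft_iff {O : AddSubgroup K} (hO : ∀ x : K, x ∈ O ↔ Valued.v x ≤ 1) {c : K} (hc : c ≠ 0) (y : K) :
    y ∈ O.map (AddMonoidHom.mulLeft c) ↔ Valued.v y ≤ Valued.v c := by
  rw [AddSubgroup.mem_map]
  constructor
  · rintro ⟨o, ho, rfl⟩
    rw [AddMonoidHom.coe_mulLeft, Valuation.map_mul]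
    exact mul_le_of_le_one_right' ((hO o).1 ho)
  · intro hy
    refine ⟨c⁻¹ * y, (hO _).2 ?_, by rw [AddMonoidHom.coe_mulLeft, mul_inv_cancel_left₀ hc]⟩
    rw [Valuation.map_mul, map_inv₀]
    have hvc : Valued.v c ≠ 0 := (Valuation.ne_zero_iff _).2 hc
    calc (Valued.v c)⁻¹ * Valued.v y ≤ (Valued.v c)⁻¹ * Valued.v c := mul_le_mul_right hy _
      _ = 1 := inv_mul_cancel₀ hvc

/-- `c·O⁻ = O⁻ ∩ c·O` for `σ c = c ≠ 0` (the skew ball scaled by a σ-fixed scalar). [cite: Serre1979, Ch. II §3] -/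
theorem map_mulLeft_skew_eq_inf {O : AddSubgroup K} (hO : ∀ x : K, x ∈ O ↔ Valued.v x ≤ 1)
    {Om : AddSubgroup K} (hOm : ∀ x : K, x ∈ Om ↔ σ x = -x ∧ Valued.v x ≤ 1) {c : K} (hc : c ≠ 0) (hσc : σ c = c) (hvc : Valued.v c ≤ 1) :
    Om.map (AddMonoidHom.mulLeft c) = O.map (AddMonoidHom.mulLeft c) ⊓ Om := by
  ext y
  rw [AddSubgroup.mem_inf, mem_map_mulLeft_iff hO hc, AddSubgroup.mem_map, hOm]
  constructor
  · rintro ⟨o, ho, rfl⟩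
    obtain ⟨hσo, hvo⟩ := (hOm o).1 ho
    rw [AddMonoidHom.coe_mulLeft, Valuation.map_mul, map_mul, hσc, hσo, mul_neg]
    exact ⟨mul_le_of_le_one_right' hvo, rfl, (mul_le_mul' hvc hvo).trans_eq (one_mul 1)⟩
  · rintro ⟨hvy, hσy, -⟩
    have hvc0 : Valued.v c ≠ 0 := (Valuation.ne_zero_iff _).2 hc
    refine ⟨c⁻¹ * y, (hOm _).2 ⟨by rw [map_mul, map_inv₀, hσc, hσy, mul_neg], ?_⟩, by rw [AddMonoidHom.coe_mulLeft, mul_inv_cancel_left₀ hc]⟩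
    rw [Valuation.map_mul, map_inv₀]
    calc (Valued.v c)⁻¹ * Valued.v y ≤ (Valued.v c)⁻¹ * Valued.v c := mul_le_mul_right hvy _
      _ = 1 := inv_mul_cancel₀ hvc0

end Summit.HodgeConjecture.HodgeConjecture.Cruxes.H413.K2E3TransvectionCentralizerLevel

end
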